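import Summits.QuantumAdvantage.AdviceFreeQNC0.LayerGrowthRatios
import HarnessLib

/-!
# Cell qa-qnc0 (rung F-Q1, route RingFrame, crux α, line `product`): weak proportional residue
# avoidance at EVERY degree — `|supp g| ≤ 17·C(2q,q)²·|supp g ∩ {|u| ≡ r (3)}|` for `deg g < q = 2^j`, `n ≥ 16q²`

Planner statement HOME/qa-qnc0-p1/Sketch5.lean §18.4 (`WeakPLDAMSq`, "PROVED in prose from
`LayerGrowth` and its reflection"), now a kernel theorem, literally in the planner's shape
(`weakPLDAMSq`): for `d < q = 2^j`, `16·4^j ≤ n`, `g ∈ lowDeg 𝔽₂ n d` and every `r`,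
`#{u : g u ≠ 0} ≤ 17·C(2q,q)²·#{u : g u ≠ 0, |u| ≡ r (mod 3)}`.  So the PLDAMS ladder holds at every
degree with the (weak) constant `κ₀ = 1/(17·C(2q,q)²) ≥ 2^{−8d}/17` — the unconditional rung of
the line `product`; TARGET.md §18.3 explains why `2^{−Θ(d)}` is the ceiling of such rooted arguments.

Proof.  Write `N_k = #{u : g u ≠ 0, |u| = k}` and `C = C(2q,q)`.  `layerGrowth` in ratio form reads
`N_k·C(n,k+q) ≤ N_{k+q}·C(n,k)·C` (`k + 2q ≤ n`), and by complementing the variables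
(`Hegedus.cpl`) also `N_k·C(n,k−q) ≤ N_{k−q}·C(n,k)·C` (`2q ≤ k`); two steps give the factor `C²`.
Since `3 ∤ q`, the layers `k`, `k ± q`, `k ± 2q` realise all residues mod 3; for `k ≢ r` we pick a
target layer `t(k) ≡ r` among `k ± q, k ± 2q`, one or two steps TOWARDS the middle (overshooting it
by at most `q`, or — when `k` is within `q` of the middle — one step of length `q` away from it), so
that `C(n,k) ≤ 3·C(n,t(k))` (`choose_le_exp_mul_choose` with `e^{8q²/n} ≤ e^{1/2}`, resp. the one-step
ratio `((n−k+q)/(k−q+1))^q ≤ e^{16q²/n} ≤ e`).  Hence `N_k ≤ 3C²·N_{t(k)}`, every target is hit from at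
most the four layers `t ± q, t ± 2q`, and `|supp g| = Σ_k N_k ≤ (1 + 12C²)·Σ_{m ≡ r} N_m`.

The statement is the cell's (qa-qnc0 TARGET.md §18.4), not in print.  WHAT THIS IS NOT: the
constant is exponentially small in `d` (no bearing on `PLDAMSCLog`/`LDMAPolylog` beyond the rooted
regime); nothing on α; no separation.
-/

noncomputable section

namespace Summit.QuantumAdvantage.AdviceFreeQNC0

open Finset
open Literature.Computability.MetaComplexity Literature.Computability.MetaComplexity.Smolensky
open Literature.Computability.MetaComplexity.Hegedus

variable {n : ℕ}

/-- Casting a monotonicity step: `a ≤ b ⟹ (a : ℝ) ≤ 3·b`. [folklore] -/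
private theorem cast_le_three_mul {a b : ℕ} (h : a ≤ b) : (a : ℝ) ≤ 3 * b := by
  have h1 : (a : ℝ) ≤ b := by exact_mod_cast h
  have h2 : (0 : ℝ) ≤ b := Nat.cast_nonneg b
  linarith

/-! ### The target layer -/

/-- The target layer `t(k)` for a source layer `k`: one or two `q`-steps towards the middle, or one
step away from it when `k` is within `q` of the middle. [folklore] -/
def tgtLayer (n q r k : ℕ) : ℕ :=
  if 2 * k ≤ n then
    (if (k + q) % 3 = r % 3 then k + q else if 2 * (k + q) ≤ n then k + 2 * q else k - q)
  else
    (if (k - q) % 3 = r % 3 then k - q else if n ≤ 2 * (k - q) then k - 2 * q else k + q)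

/-- Mod-3 bookkeeping: the three layers `k, k+q, k+2q` have distinct residues (`3 ∤ q`). [folklore] -/
private theorem third_residue {k q r : ℕ} (hq : q % 3 ≠ 0) (hk : k % 3 ≠ r % 3)
    (h1 : (k + q) % 3 ≠ r % 3) : (k + 2 * q) % 3 = r % 3 := by
  have h3 : k % 3 < 3 := Nat.mod_lt _ (by norm_num)
  have hq3 : q % 3 < 3 := Nat.mod_lt _ (by norm_num)
  interval_cases hkm : k % 3 <;> interval_cases hqm : q % 3 <;> omega

/-- The key per-layer estimate: for `k ≤ n`, `k ≢ r (mod 3)`, the target `t = tgtLayer n q r k`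
satisfies `t ≤ n`, `t ≡ r (mod 3)`, `k ∈ {t−2q, t−q, t+q, t+2q}`, and `N_k ≤ 3·C(2q,q)²·N_t`.
[cite: Srinivasan2023, Lemma 1.1 (Hegedűs's lemma)] -/
theorem layerCount_le_target {j d k r : ℕ} (hd : d < 2 ^ j) (hn : 16 * 4 ^ j ≤ n) (hkn : k ≤ n)
    (hkr : k % 3 ≠ r % 3) {g : CubeFn (ZMod 2) n} (hg : g ∈ lowDeg (ZMod 2) n d) :
    tgtLayer n (2 ^ j) r k ≤ n ∧ tgtLayer n (2 ^ j) r k % 3 = r % 3 ∧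
      (k = tgtLayer n (2 ^ j) r k - 2 * 2 ^ j ∨ k = tgtLayer n (2 ^ j) r k - 2 ^ j ∨
        k = tgtLayer n (2 ^ j) r k + 2 ^ j ∨ k = tgtLayer n (2 ^ j) r k + 2 * 2 ^ j) ∧
      (univ.filter fun u : Fin n → Bool => g u ≠ 0 ∧ wt u = k).card ≤
        3 * (2 * 2 ^ j).choose (2 ^ j) ^ 2 *
          (univ.filter fun u : Fin n → Bool => g u ≠ 0 ∧ wt u = tgtLayer n (2 ^ j) r k).card := by
  set q := 2 ^ j with hq
  have hq1 : 1 ≤ q := Nat.one_le_two_pow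
  have hq3 : q % 3 ≠ 0 := two_pow_mod_three_ne_zero j
  have h4j : 4 ^ j = q ^ 2 := by rw [hq, ← pow_mul, pow_mul']; norm_num
  rw [h4j] at hn
  have hqn : 16 * q ≤ n := le_trans (Nat.mul_le_mul_left _ (by nlinarith)) hn
  set C := (2 * q).choose q with hC
  have hC1 : 1 ≤ C := Nat.choose_pos (by omega)
  have hCC : C ≤ C ^ 2 := by nlinarith
  -- abbreviation for the layer counts
  set N : ℕ → ℕ := fun m => (univ.filter fun u : Fin n → Bool => g u ≠ 0 ∧ wt u = m).card with hN
  -- generic conclusion from a step inequality and a binomial comparison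
  have conclude : ∀ {t s : ℕ}, t ≤ n → s ≤ 2 → N k * n.choose t ≤ N t * n.choose k * C ^ s →
      (n.choose k : ℝ) ≤ 3 * n.choose t → N k ≤ 3 * C ^ 2 * N t := by
    intro t s htn hs hstep hbin
    have hpos : (0 : ℝ) < n.choose t := by exact_mod_cast Nat.choose_pos htn
    have hCs : (C : ℝ) ^ s ≤ (C : ℝ) ^ 2 := pow_le_pow_right₀ (by exact_mod_cast hC1) hs
    have hreal : (N k : ℝ) * n.choose t ≤ N t * n.choose k * C ^ s := by exact_mod_cast hstep
    have h2 : (N k : ℝ) * n.choose t ≤ (3 * C ^ 2 * N t : ℝ) * n.choose t := by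
      calc (N k : ℝ) * n.choose t ≤ N t * n.choose k * C ^ s := hreal
        _ ≤ N t * (3 * n.choose t) * C ^ 2 := by
            gcongr
        _ = (3 * C ^ 2 * N t : ℝ) * n.choose t := by ring
    have := le_of_mul_le_mul_right h2 hpos
    exact_mod_cast this
  by_cases hside : 2 * k ≤ n
  · -- lower half
    by_cases ha : (k + q) % 3 = r % 3
    · -- target `k + q`
      have ht : tgtLayer n q r k = k + q := by simp [tgtLayer, hside, ha]
      rw [ht]
      refine ⟨by omega, ha, Or.inr (Or.inl (by omega)), ?_⟩
      refine conclude (s := 1) (by omega) (by norm_num) ?_ ?_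
      · simpa [pow_one] using layerCount_up (k := k) hd (by omega) hg
      · by_cases hm : 2 * (k + q) ≤ n
        · exact cast_le_three_mul (choose_mono_left_half (Nat.le_add_right k q) hm)
        · exact choose_le_three_mul_choose_near_middle hq1 hn (by omega) (by omega) k
    · by_cases hb : 2 * (k + q) ≤ n
      · -- target `k + 2q`
        have ht : tgtLayer n q r k = k + 2 * q := by simp [tgtLayer, hside, ha, hb]
        rw [ht]
        refine ⟨by omega, third_residue hq3 hkr ha, Or.inl (by omega), ?_⟩
        refine conclude (s := 2) (by omega) le_rfl (layerCount_up_two (k := k) hd (by omega) hg) ?_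
        by_cases hm : 2 * (k + 2 * q) ≤ n
        · exact cast_le_three_mul (choose_mono_left_half (Nat.le_add_right k _) hm)
        · exact choose_le_three_mul_choose_near_middle hq1 hn (by omega) (by omega) k
      · -- target `k − q` (one step away from the middle)
        have ht : tgtLayer n q r k = k - q := by simp [tgtLayer, hside, ha, hb]
        rw [ht]
        have hqk : 2 * q ≤ k := by omega
        refine ⟨by omega, ?_, Or.inr (Or.inr (Or.inl (by omega))), ?_⟩
        · have := third_residue hq3 hkr ha; omega
        refine conclude (s := 1) (by omega) (by norm_num) ?_ ?_
        · simpa [pow_one] using layerCount_down (k := k) hd hqk hkn hg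
        · exact choose_le_three_mul_choose_sub hq1 hn hside (by omega)
  · -- upper half (mirror image)
    rw [not_le] at hside
    by_cases ha : (k - q) % 3 = r % 3
    · -- target `k − q`
      have ht : tgtLayer n q r k = k - q := by simp [tgtLayer, not_le.2 hside, ha]
      rw [ht]
      have hqk : 2 * q ≤ k := by omega
      refine ⟨by omega, ha, Or.inr (Or.inr (Or.inl (by omega))), ?_⟩
      refine conclude (s := 1) (by omega) (by norm_num) ?_ ?_
      · simpa [pow_one] using layerCount_down (k := k) hd hqk hkn hg
      · by_cases hm : n ≤ 2 * (k - q)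
        · exact cast_le_three_mul (choose_mono_right_half (Nat.sub_le k q) hkn hm)
        · exact choose_le_three_mul_choose_near_middle hq1 hn (by omega) (by omega) k
    · by_cases hb : n ≤ 2 * (k - q)
      · -- target `k − 2q`
        have ht : tgtLayer n q r k = k - 2 * q := by simp [tgtLayer, not_le.2 hside, ha, hb]
        rw [ht]
        have hqk : 3 * q ≤ k := by omega
        refine ⟨by omega, ?_, Or.inr (Or.inr (Or.inr (by omega))), ?_⟩
        · -- `k − 2q ≡ k + q`, the third residue
          have h1 : (k - 2 * q + q) % 3 ≠ r % 3 := by rwa [show k - 2 * q + q = k - q by omega]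
          have h0 : (k - 2 * q) % 3 ≠ r % 3 ∨ (k - 2 * q) % 3 = r % 3 := by omega
          rcases h0 with h0 | h0
          · have := third_residue hq3 h0 h1
            rw [show k - 2 * q + 2 * q = k by omega] at this
            exact absurd this hkr
          · exact h0
        refine conclude (s := 2) (by omega) le_rfl (layerCount_down_two (k := k) hd hqk hkn hg) ?_
        by_cases hm : n ≤ 2 * (k - 2 * q)
        · exact cast_le_three_mul (choose_mono_right_half (Nat.sub_le k _) hkn hm)
        · exact choose_le_three_mul_choose_near_middle hq1 hn (by omega) (by omega) k
      · -- target `k + q` (one step away from the middle, upwards)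
        have ht : tgtLayer n q r k = k + q := by simp [tgtLayer, not_le.2 hside, ha, hb]
        rw [ht]
        have hkq : k + 2 * q ≤ n := by omega
        refine ⟨by omega, ?_, Or.inr (Or.inl (by omega)), ?_⟩
        · -- `k + q ≡ k − 2q`, the third residue
          have hqk : q ≤ k := by omega
          have h0 : (k + q) % 3 ≠ r % 3 ∨ (k + q) % 3 = r % 3 := by omega
          rcases h0 with h0 | h0
          · have := third_residue hq3 hkr h0
            -- `k + 2q ≡ k − q`
            omega
          · exact h0
        refine conclude (s := 1) (by omega) (by norm_num) ?_ ?_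
        · simpa [pow_one] using layerCount_up (k := k) hd hkq hg
        · exact choose_le_three_mul_choose_add hq1 hn hside.le (by omega) (by omega)

/-! ### `WeakPLDAMSq` -/

/-- **`WeakPLDAMSq` (planner Sketch5 §18.4), literally:** for `d < q = 2^j`, `16·4^j ≤ n`,
`g ∈ lowDeg 𝔽₂ n d` and every `r`, `#{u : g u ≠ 0} ≤ 17·C(2q,q)²·#{u : g u ≠ 0, |u| ≡ r (mod 3)}`
— proportional residue avoidance with the weak constant `κ₀ = 1/(17·C(2q,q)²)` at EVERY degree.
The cell's statement (TARGET.md §18.4); inputs: Hegedűs's lemma via `layerGrowth`.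
[cite: Srinivasan2023, Lemma 1.1 (Hegedűs's lemma)] -/
theorem weakPLDAMSq :
    ∀ n j d : ℕ, d < 2 ^ j → 16 * 4 ^ j ≤ n → ∀ g : CubeFn (ZMod 2) n, g ∈ lowDeg (ZMod 2) n d → ∀ r : ℕ,
      (univ.filter fun u : Fin n → Bool => g u ≠ 0).card ≤
        17 * Nat.choose (2 * 2 ^ j) (2 ^ j) ^ 2 *
          (univ.filter fun u : Fin n → Bool => g u ≠ 0 ∧ wt u % 3 = r % 3).card := by
  intro n j d hd hn g hg r
  classical
  have hC1 : 1 ≤ (2 * 2 ^ j).choose (2 ^ j) := Nat.choose_pos (by omega)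
  set N : ℕ → ℕ := fun m => (univ.filter fun u : Fin n → Bool => g u ≠ 0 ∧ wt u = m).card with hN
  -- support and class as sums over layers
  have hsupp : (univ.filter fun u : Fin n → Bool => g u ≠ 0).card = ∑ m ∈ range (n + 1), N m := by
    rw [card_filter_ne_zero_eq_sum]
    exact Finset.sum_congr rfl fun m _ => (layerCount_eq g m).symm
  have hclass : (univ.filter fun u : Fin n → Bool => g u ≠ 0 ∧ wt u % 3 = r % 3).card =
      ∑ m ∈ (range (n + 1)).filter (fun m => m % 3 = r % 3), N m := by
    rw [card_filter_ne_zero_mod_eq_sum]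
    exact Finset.sum_congr rfl fun m _ => (layerCount_eq g m).symm
  rw [hsupp, hclass]
  set T := (range (n + 1)).filter (fun m => m % 3 = r % 3) with hT
  set S := (range (n + 1)).filter (fun m => ¬m % 3 = r % 3) with hS
  have hsplit : ∑ m ∈ range (n + 1), N m = ∑ m ∈ T, N m + ∑ m ∈ S, N m :=
    (Finset.sum_filter_add_sum_filter_not _ _ _).symm
  -- the off-class layers are charged to their targets
  have hmaps : ∀ k ∈ S, tgtLayer n (2 ^ j) r k ∈ T := by
    intro k hk
    rw [hS, Finset.mem_filter, Finset.mem_range] at hk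
    obtain ⟨h1, h2, -, -⟩ := layerCount_le_target (r := r) hd hn (by omega) hk.2 hg
    exact Finset.mem_filter.2 ⟨Finset.mem_range.2 (by omega), h2⟩
  have hcharge : ∑ k ∈ S, N k ≤ ∑ k ∈ S, 3 * (2 * 2 ^ j).choose (2 ^ j) ^ 2 * N (tgtLayer n (2 ^ j) r k) := by
    refine Finset.sum_le_sum fun k hk => ?_
    rw [hS, Finset.mem_filter, Finset.mem_range] at hk
    exact (layerCount_le_target (r := r) hd hn (by omega) hk.2 hg).2.2.2
  set C := (2 * 2 ^ j).choose (2 ^ j) with hC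
  set t : ℕ → ℕ := tgtLayer n (2 ^ j) r with ht
  have hfibre : ∑ k ∈ S, 3 * C ^ 2 * N (t k) ≤ 4 * (3 * C ^ 2) * ∑ m ∈ T, N m := by
    rw [← Finset.sum_fiberwise_of_maps_to hmaps, Finset.mul_sum]
    refine Finset.sum_le_sum fun m hm => ?_
    have hinner : ∑ k ∈ S with t k = m, 3 * C ^ 2 * N (t k) = ∑ k ∈ S with t k = m, 3 * C ^ 2 * N m :=
      Finset.sum_congr rfl fun k hk => by rw [(Finset.mem_filter.1 hk).2]
    rw [hinner, Finset.sum_const, smul_eq_mul]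
    have hcard : (S.filter fun k => t k = m).card ≤ 4 := by
      have hsub : (S.filter fun k => t k = m) ⊆
          ({m - 2 * 2 ^ j, m - 2 ^ j, m + 2 ^ j, m + 2 * 2 ^ j} : Finset ℕ) := by
        intro k hk
        rw [Finset.mem_filter, hS, Finset.mem_filter, Finset.mem_range] at hk
        obtain ⟨⟨hk1, hk2⟩, hkm⟩ := hk
        obtain ⟨-, -, h3, -⟩ := layerCount_le_target (r := r) hd hn (by omega) hk2 hg
        have hkm' : tgtLayer n (2 ^ j) r k = m := hkm
        rw [hkm'] at h3
        simp only [Finset.mem_insert, Finset.mem_singleton]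
        tauto
      refine (Finset.card_le_card hsub).trans ?_
      refine (Finset.card_insert_le _ _).trans (Nat.succ_le_succ ((Finset.card_insert_le _ _).trans
        (Nat.succ_le_succ ((Finset.card_insert_le _ _).trans ?_))))
      simp
    calc (S.filter fun k => t k = m).card * (3 * C ^ 2 * N m) ≤ 4 * (3 * C ^ 2 * N m) :=
        Nat.mul_le_mul_right _ hcard
      _ = 4 * (3 * C ^ 2) * N m := by ring
  -- assemble: `Σ_T + Σ_S ≤ (1 + 12C²)·Σ_T ≤ 17C²·Σ_T`
  rw [hsplit]
  calc ∑ m ∈ T, N m + ∑ m ∈ S, N m ≤ ∑ m ∈ T, N m + 4 * (3 * C ^ 2) * ∑ m ∈ T, N m := by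
        exact Nat.add_le_add_left (hcharge.trans hfibre) _
    _ = (1 + 12 * C ^ 2) * ∑ m ∈ T, N m := by ring
    _ ≤ 17 * C ^ 2 * ∑ m ∈ T, N m := Nat.mul_le_mul_right _ (by nlinarith)


end Summit.QuantumAdvantage.AdviceFreeQNC0
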